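import Summits.Ventures.DiscreteObjects.Hadamard.Order167WilliamsonType668

/-!
# H(668): the Williamson array with circulant blocks of order 167 ATTAINS the index-4 centraliser — converse /
# tightness of `Order167CentralizerFree668` and `Order167WilliamsonType668` (kernel)

Framing: lottery ticket; floor = certified bounds/negative ranges.

Cell pub-namedobj (venture DiscreteObjects), target (H), hadamard gen 21.  Gen 21 proved: for a signed automorphism `σ` of pair
order `167` of a Hadamard matrix of order `668`, `|C(σ) : ±⟨σ⟩| ≤ 4`, and index `4` (two centralising signed automorphisms with
distinct non-trivial involution pairs) forces the `V₄`-twisted four-circulant shape `[θ(g,h) · A_{g+h}(t − s)]`.  Here the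
classical WILLIAMSON ARRAY `W = (A B C D / −B A −D C / −C D A −B / −D −C B A)` with circulant blocks of order `167` — written as the
`V₄`-twisted array with the explicit sign table `θ_W` (`V₄ = ℤ/2 × ℤ/2`, `0 ↦ A`, `(1,0) ↦ B`, `(0,1) ↦ C`, `(1,1) ↦ D`) — is shown to
carry, for ARBITRARY block sequences `A_k` (no Hadamard hypothesis is needed for the symmetry statements):
* `williamsonArray_shift_aut`: the simultaneous block shift `σ₀ : (g, s) ↦ (g, s + 1)` as a permutation automorphism with
  `σ₀^167 = 1`, `σ₀ ≠ 1`;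
* `williamsonArray_translate_aut_a` / `_b`: the block translations `τ_a : (g, s) ↦ (g + a, s)` for `a = (1,0)` and `b = (0,1)`, with
  the signs `u_a(g) = (−1)^{g₁}`, `u_b(g) = (−1)^{g₁ + g₂}` on rows AND columns, as signed automorphisms (the quaternion units
  `i, j` acting on `A + Bi + Cj + Dk`); they commute with `σ₀`, have involution pairs, are non-trivial and distinct.
* **`williamsonArray_index_four_realized`**: hence, if `W` is Hadamard, `(W, σ₀, τ_a, τ_b)` satisfies every hypothesis of
  `exists_williamsonTypeArray_of_centralizer_index_four` — the bound `|C(σ) : ±⟨σ⟩| ≤ 4` of `Order167CentralizerFree668` is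
  ATTAINED exactly by the Williamson-type matrices, and the dictionary reads: *a Williamson-type H(668) exists ⇒ an H(668) with an
  index-4 centraliser at 167 exists ⇒ a Hadamard `V₄`-twisted four-circulant array of order 668 exists*.
Whether any of these exists is OPEN (Williamson-type matrices of order `4·167` are not known; H(668) is the smallest unknown order).
DICTIONARY / TIGHTNESS; H(668) untouched; HITS 0/4.  Ours (the quaternion symmetries of the Williamson array are classical —
Williamson 1944, Baumert–Hall 1965; Horadam 2007 §6.4.3); no `sorry`, no definitions (all maps are explicit terms), default heartbeats.
-/

namespace Summit.Ventures.DiscreteObjects.Hadamard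

open Finset BigOperators Matrix

open Literature.Combinatorics.Designs.GoethalsSeidel (IsHadamardMatrix)

/-! ### the sign table of the Williamson array and its equivariance under the two translations (finite checks) -/

/-- equivariance of the Williamson sign table `θ_W` under translation by `a = (1,0)` with the sign `(−1)^{g₁}` -/
lemma thetaW_translate_a : ∀ g h : ZMod 2 × ZMod 2,
    (if g + (1, 0) = 0 then (1 : ℤ) else if g + (1, 0) = (1, 0) then (if (h + (1, 0)).1 = 1 then 1 else -1)
      else if g + (1, 0) = (0, 1) then (if (h + (1, 0)).1 = (h + (1, 0)).2 then -1 else 1)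
      else (if (h + (1, 0)).2 = 1 then 1 else -1)) =
    (if g.1 = 0 then (1 : ℤ) else -1) * (if h.1 = 0 then (1 : ℤ) else -1) *
      (if g = 0 then (1 : ℤ) else if g = (1, 0) then (if h.1 = 1 then 1 else -1)
        else if g = (0, 1) then (if h.1 = h.2 then -1 else 1) else (if h.2 = 1 then 1 else -1)) := by
  decide

/-- equivariance of `θ_W` under translation by `b = (0,1)` with the sign `(−1)^{g₁+g₂}` -/
lemma thetaW_translate_b : ∀ g h : ZMod 2 × ZMod 2,
    (if g + (0, 1) = 0 then (1 : ℤ) else if g + (0, 1) = (1, 0) then (if (h + (0, 1)).1 = 1 then 1 else -1)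
      else if g + (0, 1) = (0, 1) then (if (h + (0, 1)).1 = (h + (0, 1)).2 then -1 else 1)
      else (if (h + (0, 1)).2 = 1 then 1 else -1)) =
    (if g.1 = g.2 then (1 : ℤ) else -1) * (if h.1 = h.2 then (1 : ℤ) else -1) *
      (if g = 0 then (1 : ℤ) else if g = (1, 0) then (if h.1 = 1 then 1 else -1)
        else if g = (0, 1) then (if h.1 = h.2 then -1 else 1) else (if h.2 = 1 then 1 else -1)) := by
  decide

/-- `(g + a) + (h + a) = g + h` in `V₄` -/
lemma v4_translate_add (a g h : ZMod 2 × ZMod 2) : (g + a) + (h + a) = g + h := by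
  have h2 : a + a = 0 := v4_facts.1 a
  calc (g + a) + (h + a) = (g + h) + (a + a) := by abel
    _ = g + h := by rw [h2, add_zero]

/-! ### the Williamson array as a `V₄`-twisted four-circulant array, and its symmetries -/

section williamson
variable (A : ZMod 2 × ZMod 2 → ZMod 167 → ℤ)

/-- powers of the block shift -/
lemma blockShift_pow_apply (n : ℕ) (x : (ZMod 2 × ZMod 2) × ZMod 167) :
    ((Equiv.prodCongr (Equiv.refl (ZMod 2 × ZMod 2)) (Equiv.addRight (1 : ZMod 167))) ^ n) x = (x.1, x.2 + n) := by
  induction n with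
  | zero => simp
  | succ n ih =>
    rw [pow_succ', Equiv.Perm.mul_apply, ih]
    simp only [Equiv.prodCongr_apply, Prod.map_apply, Equiv.refl_apply, Equiv.coe_addRight, Nat.cast_succ]
    ring_nf

/-- **the block shift `σ₀ : (g, s) ↦ (g, s+1)` is a permutation automorphism of the Williamson array, of order 167** -/
theorem williamsonArray_shift_aut :
    IsSignedAut (Matrix.of fun (a b : (ZMod 2 × ZMod 2) × ZMod 167) =>
        (if a.1 = 0 then (1 : ℤ) else if a.1 = (1, 0) then (if b.1.1 = 1 then 1 else -1)
          else if a.1 = (0, 1) then (if b.1.1 = b.1.2 then -1 else 1) else (if b.1.2 = 1 then 1 else -1)) *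
        A (a.1 + b.1) (b.2 - a.2))
      (Equiv.prodCongr (Equiv.refl (ZMod 2 × ZMod 2)) (Equiv.addRight (1 : ZMod 167)))
      (Equiv.prodCongr (Equiv.refl (ZMod 2 × ZMod 2)) (Equiv.addRight (1 : ZMod 167))) (fun _ => 1) (fun _ => 1) ∧
    (Equiv.prodCongr (Equiv.refl (ZMod 2 × ZMod 2)) (Equiv.addRight (1 : ZMod 167))) ^ 167 = 1 ∧
    (Equiv.prodCongr (Equiv.refl (ZMod 2 × ZMod 2)) (Equiv.addRight (1 : ZMod 167))) ≠ 1 := by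
  refine ⟨⟨fun _ => Or.inl rfl, fun _ => Or.inl rfl, fun i j => ?_⟩, ?_, ?_⟩
  · obtain ⟨g, s⟩ := i
    obtain ⟨h, t⟩ := j
    show (if g = 0 then (1 : ℤ) else if g = (1, 0) then (if h.1 = 1 then 1 else -1)
          else if g = (0, 1) then (if h.1 = h.2 then -1 else 1) else (if h.2 = 1 then 1 else -1)) *
        A (g + h) ((t + 1) - (s + 1)) =
      1 * 1 * ((if g = 0 then (1 : ℤ) else if g = (1, 0) then (if h.1 = 1 then 1 else -1)
          else if g = (0, 1) then (if h.1 = h.2 then -1 else 1) else (if h.2 = 1 then 1 else -1)) * A (g + h) (t - s))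
    rw [show t + 1 - (s + 1) = t - s by ring]
    ring
  · apply Equiv.ext
    intro x
    rw [blockShift_pow_apply, Equiv.Perm.one_apply]
    have h : ((167 : ℕ) : ZMod 167) = 0 := by decide
    rw [h, add_zero]
  · intro h
    have h1 : (Equiv.prodCongr (Equiv.refl (ZMod 2 × ZMod 2)) (Equiv.addRight (1 : ZMod 167))) ((0, 0), 0) =
        ((0, 0), 0) := by rw [h]; rfl
    exact absurd h1 (by decide)

/-- **the translation by `a = (1,0)` with signs `(−1)^{g₁}` on rows and columns is a signed automorphism of the Williamson array**
(the unit `i`), commuting with the shift, with a non-trivial involution as permutation part -/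
theorem williamsonArray_translate_aut_a :
    IsSignedAut (Matrix.of fun (a b : (ZMod 2 × ZMod 2) × ZMod 167) =>
        (if a.1 = 0 then (1 : ℤ) else if a.1 = (1, 0) then (if b.1.1 = 1 then 1 else -1)
          else if a.1 = (0, 1) then (if b.1.1 = b.1.2 then -1 else 1) else (if b.1.2 = 1 then 1 else -1)) *
        A (a.1 + b.1) (b.2 - a.2))
      (Equiv.prodCongr (Equiv.addRight ((1, 0) : ZMod 2 × ZMod 2)) (Equiv.refl (ZMod 167)))
      (Equiv.prodCongr (Equiv.addRight ((1, 0) : ZMod 2 × ZMod 2)) (Equiv.refl (ZMod 167)))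
      (fun x => if x.1.1 = 0 then 1 else -1) (fun y => if y.1.1 = 0 then 1 else -1) ∧
    Commute (Equiv.prodCongr (Equiv.addRight ((1, 0) : ZMod 2 × ZMod 2)) (Equiv.refl (ZMod 167)))
      (Equiv.prodCongr (Equiv.refl (ZMod 2 × ZMod 2)) (Equiv.addRight (1 : ZMod 167))) ∧
    (Equiv.prodCongr (Equiv.addRight ((1, 0) : ZMod 2 × ZMod 2)) (Equiv.refl (ZMod 167))) ^ 2 = 1 ∧
    (Equiv.prodCongr (Equiv.addRight ((1, 0) : ZMod 2 × ZMod 2)) (Equiv.refl (ZMod 167))) ≠ 1 := by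
  refine ⟨⟨fun x => ?_, fun y => ?_, fun i j => ?_⟩, ?_, ?_, ?_⟩
  · by_cases h : x.1.1 = 0 <;> simp [h]
  · by_cases h : y.1.1 = 0 <;> simp [h]
  · obtain ⟨g, s⟩ := i
    obtain ⟨h, t⟩ := j
    show (if g + (1, 0) = 0 then (1 : ℤ) else if g + (1, 0) = (1, 0) then (if (h + (1, 0)).1 = 1 then 1 else -1)
          else if g + (1, 0) = (0, 1) then (if (h + (1, 0)).1 = (h + (1, 0)).2 then -1 else 1)
          else (if (h + (1, 0)).2 = 1 then 1 else -1)) * A ((g + (1, 0)) + (h + (1, 0))) (t - s) =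
      (if g.1 = 0 then (1 : ℤ) else -1) * (if h.1 = 0 then (1 : ℤ) else -1) *
        ((if g = 0 then (1 : ℤ) else if g = (1, 0) then (if h.1 = 1 then 1 else -1)
          else if g = (0, 1) then (if h.1 = h.2 then -1 else 1) else (if h.2 = 1 then 1 else -1)) * A (g + h) (t - s))
    rw [thetaW_translate_a g h, v4_translate_add]
    ring
  · exact Equiv.ext fun x => by obtain ⟨g, s⟩ := x; rfl
  · rw [pow_two]
    apply Equiv.ext
    rintro ⟨g, s⟩
    show ((g + (1, 0)) + (1, 0), s) = (g, s)
    have h : ((1, 0) : ZMod 2 × ZMod 2) + (1, 0) = 0 := by decide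
    rw [add_assoc, h, add_zero]
  · intro h
    have h1 : (Equiv.prodCongr (Equiv.addRight ((1, 0) : ZMod 2 × ZMod 2)) (Equiv.refl (ZMod 167))) ((0, 0), 0) =
        ((0, 0), 0) := by rw [h]; rfl
    exact absurd h1 (by decide)

/-- **the translation by `b = (0,1)` with signs `(−1)^{g₁+g₂}` is a signed automorphism of the Williamson array** (the unit `j`),
commuting with the shift, with a non-trivial involution as permutation part, different from that of `τ_a` -/
theorem williamsonArray_translate_aut_b :
    IsSignedAut (Matrix.of fun (a b : (ZMod 2 × ZMod 2) × ZMod 167) =>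
        (if a.1 = 0 then (1 : ℤ) else if a.1 = (1, 0) then (if b.1.1 = 1 then 1 else -1)
          else if a.1 = (0, 1) then (if b.1.1 = b.1.2 then -1 else 1) else (if b.1.2 = 1 then 1 else -1)) *
        A (a.1 + b.1) (b.2 - a.2))
      (Equiv.prodCongr (Equiv.addRight ((0, 1) : ZMod 2 × ZMod 2)) (Equiv.refl (ZMod 167)))
      (Equiv.prodCongr (Equiv.addRight ((0, 1) : ZMod 2 × ZMod 2)) (Equiv.refl (ZMod 167)))
      (fun x => if x.1.1 = x.1.2 then 1 else -1) (fun y => if y.1.1 = y.1.2 then 1 else -1) ∧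
    Commute (Equiv.prodCongr (Equiv.addRight ((0, 1) : ZMod 2 × ZMod 2)) (Equiv.refl (ZMod 167)))
      (Equiv.prodCongr (Equiv.refl (ZMod 2 × ZMod 2)) (Equiv.addRight (1 : ZMod 167))) ∧
    (Equiv.prodCongr (Equiv.addRight ((0, 1) : ZMod 2 × ZMod 2)) (Equiv.refl (ZMod 167))) ^ 2 = 1 ∧
    (Equiv.prodCongr (Equiv.addRight ((0, 1) : ZMod 2 × ZMod 2)) (Equiv.refl (ZMod 167))) ≠ 1 ∧
    (Equiv.prodCongr (Equiv.addRight ((1, 0) : ZMod 2 × ZMod 2)) (Equiv.refl (ZMod 167))) ≠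
      (Equiv.prodCongr (Equiv.addRight ((0, 1) : ZMod 2 × ZMod 2)) (Equiv.refl (ZMod 167))) := by
  refine ⟨⟨fun x => ?_, fun y => ?_, fun i j => ?_⟩, ?_, ?_, ?_, ?_⟩
  · by_cases h : x.1.1 = x.1.2 <;> simp [h]
  · by_cases h : y.1.1 = y.1.2 <;> simp [h]
  · obtain ⟨g, s⟩ := i
    obtain ⟨h, t⟩ := j
    show (if g + (0, 1) = 0 then (1 : ℤ) else if g + (0, 1) = (1, 0) then (if (h + (0, 1)).1 = 1 then 1 else -1)
          else if g + (0, 1) = (0, 1) then (if (h + (0, 1)).1 = (h + (0, 1)).2 then -1 else 1)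
          else (if (h + (0, 1)).2 = 1 then 1 else -1)) * A ((g + (0, 1)) + (h + (0, 1))) (t - s) =
      (if g.1 = g.2 then (1 : ℤ) else -1) * (if h.1 = h.2 then (1 : ℤ) else -1) *
        ((if g = 0 then (1 : ℤ) else if g = (1, 0) then (if h.1 = 1 then 1 else -1)
          else if g = (0, 1) then (if h.1 = h.2 then -1 else 1) else (if h.2 = 1 then 1 else -1)) * A (g + h) (t - s))
    rw [thetaW_translate_b g h, v4_translate_add]
    ring
  · exact Equiv.ext fun x => by obtain ⟨g, s⟩ := x; rfl
  · rw [pow_two]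
    apply Equiv.ext
    rintro ⟨g, s⟩
    show ((g + (0, 1)) + (0, 1), s) = (g, s)
    have h : ((0, 1) : ZMod 2 × ZMod 2) + (0, 1) = 0 := by decide
    rw [add_assoc, h, add_zero]
  · intro h
    have h1 : (Equiv.prodCongr (Equiv.addRight ((0, 1) : ZMod 2 × ZMod 2)) (Equiv.refl (ZMod 167))) ((0, 0), 0) =
        ((0, 0), 0) := by rw [h]; rfl
    exact absurd h1 (by decide)
  · intro h
    have h1 : (Equiv.prodCongr (Equiv.addRight ((1, 0) : ZMod 2 × ZMod 2)) (Equiv.refl (ZMod 167))) ((0, 0), 0) =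
        (Equiv.prodCongr (Equiv.addRight ((0, 1) : ZMod 2 × ZMod 2)) (Equiv.refl (ZMod 167))) ((0, 0), 0) := by rw [h]
    exact absurd h1 (by decide)

/-- **The Williamson array attains index 4.**  If the Williamson array with circulant blocks `A, B, C, D` of order `167` is a
Hadamard matrix, then it carries a signed automorphism `σ₀` of pair exponent `167` and two signed automorphisms commuting with it
whose permutation pairs are distinct non-trivial involutions — exactly the hypotheses of
`exists_williamsonTypeArray_of_centralizer_index_four` / the maximal case of `hadamard668_order167_centralizer_index_le_four`. -/
theorem williamsonArray_index_four_realized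
    (hW : IsHadamardMatrix (Matrix.of fun (a b : (ZMod 2 × ZMod 2) × ZMod 167) =>
        (if a.1 = 0 then (1 : ℤ) else if a.1 = (1, 0) then (if b.1.1 = 1 then 1 else -1)
          else if a.1 = (0, 1) then (if b.1.1 = b.1.2 then -1 else 1) else (if b.1.2 = 1 then 1 else -1)) *
        A (a.1 + b.1) (b.2 - a.2))) :
    ∃ (M : Matrix ((ZMod 2 × ZMod 2) × ZMod 167) ((ZMod 2 × ZMod 2) × ZMod 167) ℤ)
      (π κ π₁ κ₁ π₂ κ₂ : Equiv.Perm ((ZMod 2 × ZMod 2) × ZMod 167)) (d e d₁ e₁ d₂ e₂ : (ZMod 2 × ZMod 2) × ZMod 167 → ℤ),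
      IsHadamardMatrix M ∧ Fintype.card ((ZMod 2 × ZMod 2) × ZMod 167) = 668 ∧
      IsSignedAut M π κ d e ∧ π ^ 167 = 1 ∧ κ ^ 167 = 1 ∧ (π ≠ 1 ∨ κ ≠ 1) ∧
      IsSignedAut M π₁ κ₁ d₁ e₁ ∧ IsSignedAut M π₂ κ₂ d₂ e₂ ∧ Commute π₁ π ∧ Commute κ₁ κ ∧ Commute π₂ π ∧ Commute κ₂ κ ∧
      π₁ ^ 2 = 1 ∧ κ₁ ^ 2 = 1 ∧ π₂ ^ 2 = 1 ∧ κ₂ ^ 2 = 1 ∧ (π₁ ≠ 1 ∨ κ₁ ≠ 1) ∧ (π₂ ≠ 1 ∨ κ₂ ≠ 1) ∧ (π₁ ≠ π₂ ∨ κ₁ ≠ κ₂) := by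
  obtain ⟨hσ, h167, hσne⟩ := williamsonArray_shift_aut A
  obtain ⟨ha, hca, ha2, hane⟩ := williamsonArray_translate_aut_a A
  obtain ⟨hb, hcb, hb2, hbne, hab⟩ := williamsonArray_translate_aut_b A
  exact ⟨_, _, _, _, _, _, _, _, _, _, _, _, _, hW, by simp [ZMod.card], hσ, h167, h167, Or.inl hσne, ha, hb, hca, hca, hcb,
    hcb, ha2, ha2, hb2, hb2, Or.inl hane, Or.inl hbne, Or.inl hab⟩

end williamson

end Summit.Ventures.DiscreteObjects.Hadamard
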